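import Literature.Analysis.FluidPDE.ChaeAsymptoticallySelfSimilarWeakLimit
import Literature.Analysis.FluidPDE.LerayHopfNSRescale
import Literature.Analysis.FluidPDE.CriticalSpaces
import HarnessLib

/-!
# Dilations act continuously on `L^p(ℝ³)`; the backward self-similar field as a `C_t L^p` family

Analysis/FluidPDE proofs file (theorems only: no definitions, no named facts) on the discharge
path of `Literature.Analysis.FluidPDE.chae2007_asymptoticallySelfSimilar_local` (D. Chae, Math. Ann.
338 (2007), Thm 1.5): the `L^p` versions, `1 ≤ p < ∞`, of the `L³` lemmas of the seventh
companion (`ChaeAsymptoticallySelfSimilarProfileThree.lean`, §Dilation, §BackwardField), needed for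
the profile conclusion `V̄ = 0` in the subcritical case `3 < p < ∞` (where the blow-up limit
`u_V(t) = (−t)^{-1/2} V̄(·/√(−t))` has slices in `L^p` with `‖u_V(t)‖_{L^p} = (−t)^{(3/p−1)/2}‖V̄‖_{L^p}`
and must be shown to be an `L^p`-continuous curve):

* `tendsto_eLpNorm_rescaleData_sub_of_continuous_Lp` — for a continuous compactly supported `g`
  and `c₀ > 0`, `‖c g(c ·) − c₀ g(c₀ ·)‖_{L^p} → 0` as `c → c₀` (dominated convergence);
* `tendsto_eLpNorm_rescaleData_sub_Lp` — the same for every `V ∈ L^p` (density of `C_c` in `L^p`,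
  Mathlib's `MemLp.exists_hasCompactSupport_eLpNorm_sub_le`, and the scaling of `L^p` norms
  `eLpNorm_nsRescaleData_of_ne_zero`, whose factor `|c|^{1−3/p}` is bounded near `c₀`);
* `continuousInLpOn_rescaleData_comp_Lp` — `s ↦ c(s) V(c(s) ·)` is a `C(S; L^p)` family for a
  continuous positive `c` on an open `S`;
* `continuousInLpOn_lerayBackward_shift_Lp`, `eLpNorm_lerayBackward_shift_Lp` — the shifted
  backward field `w(s) = u_V(s − 1) = rescaleData (√(1−s))⁻¹ V` is in `C((−∞,1); L^p)` with
  `‖w(s)‖_{L^p} = (√(1−s))^{3/p−1} ‖V‖_{L^p}` hence `≤ max(1, (1−S)^{-1/2}) ‖V‖_{L^p}`-type bounds on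
  `s ≤ S < 1`.

## References

* D. Chae, Math. Ann. 338 (2007) = arXiv:math/0604234, (3.13) and the proof of Thm 1.5 (arXiv p. 8)
  [Chae2007].
* T. Kato, Math. Z. 187 (1984), §1 (scaling of `L^p` norms) [Kato1984].
-/

noncomputable section

open _root_.MeasureTheory Set Function Filter Metric TopologicalSpace
open scoped NNReal ENNReal _root_.Topology

namespace Literature.Analysis.FluidPDE

/-- Local notation for physical space `ℝ³ = EuclideanSpace ℝ (Fin 3)`. -/
local notation "ℝ³" => EuclideanSpace ℝ (Fin 3)

/-! ### Dilations act continuously on `L^p` -/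

section DilationLp

variable {p : ℝ≥0∞}

/-- `rescaleData` is linear in the field (subtraction). [folklore] -/
theorem rescaleData_sub' (c : ℝ) (V W : ℝ³ → ℝ³) :
    rescaleData c (V - W) = rescaleData c V - rescaleData c W := by
  funext x
  simp [rescaleData, smul_sub]

/-- **Scaling of `L^p` norms in dimension three**: `‖c V(c ·)‖_{L^p} = |c| · |c⁻³|^{1/p} ‖V‖_{L^p}`
(`c ≠ 0`). [cite: Kato1984, §1] -/
theorem eLpNorm_rescaleData_eq (p : ℝ≥0∞) (V : ℝ³ → ℝ³) {c : ℝ} (hc : c ≠ 0) :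
    eLpNorm (rescaleData c V) p volume =
      ‖c‖ₑ * ENNReal.ofReal |(c ^ 3)⁻¹| ^ (1 / p).toReal * eLpNorm V p volume := by
  rw [show rescaleData c V = nsRescaleData c V from rfl, eLpNorm_nsRescaleData_of_ne_zero p V hc,
    finrank_euclideanSpace_fin]

/-- **Dilations of a continuous compactly supported field depend continuously on the scale in
`L^p`**, `1 ≤ p < ∞`: `‖c g(c ·) − c₀ g(c₀ ·)‖_{L^p} → 0` as `c → c₀ > 0` (dominated convergence:
near `c₀` the fields are uniformly bounded and supported in a fixed ball). [folklore] -/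
theorem tendsto_eLpNorm_rescaleData_sub_of_continuous_Lp (hp1 : 1 ≤ p) (hptop : p ≠ ∞)
    {g : ℝ³ → ℝ³} (hg : Continuous g) (hgc : HasCompactSupport g) {c₀ : ℝ} (hc₀ : 0 < c₀) :
    Tendsto (fun c => eLpNorm (rescaleData c g - rescaleData c₀ g) p volume) (𝓝 c₀) (𝓝 0) := by
  set r : ℝ := p.toReal with hr
  have hp0 : p ≠ 0 := (lt_of_lt_of_le zero_lt_one hp1).ne'
  have hr0 : 0 < r := ENNReal.toReal_pos hp0 hptop
  obtain ⟨Cg, hCg⟩ := hg.bounded_above_of_compact_support hgc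
  have hCg0 : 0 ≤ Cg := (norm_nonneg _).trans (hCg 0)
  obtain ⟨R, hR, hsupp⟩ : ∃ R : ℝ, 0 < R ∧ tsupport g ⊆ closedBall (0 : ℝ³) R := by
    obtain ⟨R₀, hR₀⟩ := hgc.isCompact.isBounded.subset_closedBall (0 : ℝ³)
    exact ⟨max R₀ 1, by positivity, hR₀.trans (closedBall_subset_closedBall (le_max_left _ _))⟩
  have hg0 : ∀ x, R < ‖x‖ → g x = 0 := fun x hx =>
    image_eq_zero_of_notMem_tsupport fun h => (not_le.2 hx) (mem_closedBall_zero_iff.1 (hsupp h))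
  -- the `L^p` norm through the integral of the `r`-th power
  have hnorm : ∀ c, eLpNorm (rescaleData c g - rescaleData c₀ g) p volume =
      (∫⁻ x, ‖rescaleData c g x - rescaleData c₀ g x‖ₑ ^ r) ^ (1 / r) := fun c => by
    rw [eLpNorm_eq_lintegral_rpow_enorm_toReal hp0 hptop]
    simp only [hr, Pi.sub_apply]
  simp only [hnorm]
  suffices h : Tendsto (fun c => ∫⁻ x, ‖rescaleData c g x - rescaleData c₀ g x‖ₑ ^ r) (𝓝 c₀)
      (𝓝 0) by
    have := ((ENNReal.continuous_rpow_const (y := 1 / r)).tendsto 0).comp h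
    rwa [ENNReal.zero_rpow_of_pos (by positivity)] at this
  -- dominated convergence on the window `c ∈ (c₀/2, 2c₀)`
  set B : ℝ≥0∞ := ENNReal.ofReal ((2 * (2 * c₀) * Cg) ^ r) with hB
  set bound : ℝ³ → ℝ≥0∞ := (closedBall (0 : ℝ³) (2 * R / c₀)).indicator fun _ => B with hbound
  have hwin : ∀ᶠ c in 𝓝 c₀, c ∈ Ioo (c₀ / 2) (2 * c₀) := Ioo_mem_nhds (by linarith) (by linarith)
  have hmeas : ∀ᶠ c in 𝓝 c₀, Measurable fun x => ‖rescaleData c g x - rescaleData c₀ g x‖ₑ ^ r := by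
    refine Eventually.of_forall fun c => ?_
    have h1 : Continuous (rescaleData c g) := (hg.comp (continuous_const_smul c)).const_smul c
    have h2 : Continuous (rescaleData c₀ g) := (hg.comp (continuous_const_smul c₀)).const_smul c₀
    exact ((h1.sub h2).measurable.enorm.pow_const _)
  have hfin : ∫⁻ x, bound x ≠ ⊤ := by
    rw [hbound, lintegral_indicator measurableSet_closedBall, setLIntegral_const]
    exact ENNReal.mul_ne_top ENNReal.ofReal_ne_top measure_closedBall_lt_top.ne
  have hlim : ∀ᵐ x ∂(volume : Measure ℝ³),
      Tendsto (fun c : ℝ => ‖rescaleData c g x - rescaleData c₀ g x‖ₑ ^ r)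
        (𝓝 c₀) (𝓝 ((fun _ : ℝ³ => (0 : ℝ≥0∞)) x)) := by
    refine Eventually.of_forall fun x => ?_
    have hcont : Continuous fun c : ℝ => rescaleData c g x := by
      simp only [rescaleData]
      exact continuous_id.smul (hg.comp (continuous_id.smul continuous_const))
    have h1 : Tendsto (fun c : ℝ => rescaleData c g x - rescaleData c₀ g x) (𝓝 c₀) (𝓝 0) := by
      have hc2 : Continuous fun c : ℝ => rescaleData c g x - rescaleData c₀ g x :=
        hcont.sub continuous_const
      have := hc2.tendsto c₀
      simp only [sub_self] at this
      exact this
    have h2 : Tendsto (fun c : ℝ => ‖rescaleData c g x - rescaleData c₀ g x‖ₑ) (𝓝 c₀) (𝓝 0) := by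
      have := h1.enorm
      rwa [enorm_zero] at this
    have h3 := ((ENNReal.continuous_rpow_const (y := r)).tendsto 0).comp h2
    rwa [ENNReal.zero_rpow_of_pos hr0] at h3
  have hdom : ∀ᶠ c in 𝓝 c₀, ∀ᵐ x ∂(volume : Measure ℝ³),
      ‖rescaleData c g x - rescaleData c₀ g x‖ₑ ^ r ≤ bound x := by
    filter_upwards [hwin] with c hc
    refine Eventually.of_forall fun x => ?_
    have hcpos : 0 < c := by linarith [hc.1]
    by_cases hx : x ∈ closedBall (0 : ℝ³) (2 * R / c₀)
    · rw [hbound, indicator_of_mem hx, hB]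
      have hpt : ‖rescaleData c g x - rescaleData c₀ g x‖ ≤ 2 * (2 * c₀) * Cg := by
        calc ‖rescaleData c g x - rescaleData c₀ g x‖
            ≤ ‖rescaleData c g x‖ + ‖rescaleData c₀ g x‖ := norm_sub_le _ _
          _ ≤ (2 * c₀) * Cg + (2 * c₀) * Cg := by
              refine add_le_add ?_ ?_
              · rw [rescaleData, norm_smul, Real.norm_of_nonneg hcpos.le]
                exact mul_le_mul hc.2.le (hCg _) (norm_nonneg _) (by linarith)
              · rw [rescaleData, norm_smul, Real.norm_of_nonneg hc₀.le]
                exact mul_le_mul (by linarith) (hCg _) (norm_nonneg _) (by linarith)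
          _ = 2 * (2 * c₀) * Cg := by ring
      calc ‖rescaleData c g x - rescaleData c₀ g x‖ₑ ^ r
          = ENNReal.ofReal (‖rescaleData c g x - rescaleData c₀ g x‖ ^ r) := by
            rw [← ofReal_norm, ENNReal.ofReal_rpow_of_nonneg (norm_nonneg _) hr0.le]
        _ ≤ ENNReal.ofReal ((2 * (2 * c₀) * Cg) ^ r) :=
            ENNReal.ofReal_le_ofReal (Real.rpow_le_rpow (norm_nonneg _) hpt hr0.le)
    · have hxR : 2 * R / c₀ < ‖x‖ := not_le.1 fun h => hx (mem_closedBall_zero_iff.2 h)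
      have v1 : g (c • x) = 0 := by
        refine hg0 _ ?_
        rw [norm_smul, Real.norm_of_nonneg hcpos.le]
        rw [div_lt_iff₀ hc₀] at hxR
        nlinarith [hc.1, norm_nonneg x]
      have v2 : g (c₀ • x) = 0 := by
        refine hg0 _ ?_
        rw [norm_smul, Real.norm_of_nonneg hc₀.le]
        rw [div_lt_iff₀ hc₀] at hxR
        nlinarith [norm_nonneg x]
      rw [hbound, indicator_of_notMem hx]
      simp [rescaleData, v1, v2, hr0]
  have key := tendsto_lintegral_filter_of_dominated_convergence bound hmeas hdom hfin hlim
  rwa [lintegral_zero] at key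

/-- **Dilations act continuously on `L^p(ℝ³)`**, `1 ≤ p < ∞`: for `V ∈ L^p` and `c₀ > 0`,
`‖c V(c ·) − c₀ V(c₀ ·)‖_{L^p} → 0` as `c → c₀` (density of continuous compactly supported fields;
the scaling factor `|c|·|c⁻³|^{1/p}` of `eLpNorm_rescaleData_eq` is bounded on the window
`c ∈ (c₀/2, 2c₀)`). [folklore] -/
theorem tendsto_eLpNorm_rescaleData_sub_Lp (hp1 : 1 ≤ p) (hptop : p ≠ ∞) {V : ℝ³ → ℝ³}
    (hV : MemLp V p volume) {c₀ : ℝ} (hc₀ : 0 < c₀) :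
    Tendsto (fun c => eLpNorm (rescaleData c V - rescaleData c₀ V) p volume) (𝓝 c₀) (𝓝 0) := by
  -- the bound of the scaling factor on the window
  set K : ℝ≥0∞ := ENNReal.ofReal (2 * c₀) * ENNReal.ofReal ((c₀ / 2) ^ 3)⁻¹ ^ (1 / p).toReal
    with hK
  have hKtop : K ≠ ⊤ := ENNReal.mul_ne_top ENNReal.ofReal_ne_top
    (ENNReal.rpow_ne_top_of_nonneg ENNReal.toReal_nonneg ENNReal.ofReal_ne_top)
  have hfac : ∀ c ∈ Ioo (c₀ / 2) (2 * c₀),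
      ‖c‖ₑ * ENNReal.ofReal |(c ^ 3)⁻¹| ^ (1 / p).toReal ≤ K := by
    intro c hc
    have hcpos : 0 < c := by linarith [hc.1]
    rw [hK]
    refine mul_le_mul' ?_ ?_
    · rw [Real.enorm_eq_ofReal hcpos.le]
      exact ENNReal.ofReal_le_ofReal hc.2.le
    · refine ENNReal.rpow_le_rpow (ENNReal.ofReal_le_ofReal ?_) ENNReal.toReal_nonneg
      rw [abs_of_pos (by positivity)]
      exact inv_anti₀ (by positivity) (pow_le_pow_left₀ (by positivity) hc.1.le 3)
  rw [ENNReal.tendsto_nhds_zero]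
  intro ε hε
  -- the approximant
  have hδ0 : 0 < (ε / 3) / (K + 1) :=
    ENNReal.div_pos (ENNReal.div_pos hε.ne' (by norm_num)).ne' (by
      exact ENNReal.add_ne_top.2 ⟨hKtop, ENNReal.one_ne_top⟩)
  obtain ⟨g, hgc, hgε, hg, hgp⟩ := hV.exists_hasCompactSupport_eLpNorm_sub_le hptop hδ0.ne'
  have hmid := tendsto_eLpNorm_rescaleData_sub_of_continuous_Lp hp1 hptop hg hgc hc₀
  rw [ENNReal.tendsto_nhds_zero] at hmid
  have hwin : ∀ᶠ c in 𝓝 c₀, c ∈ Ioo (c₀ / 2) (2 * c₀) := Ioo_mem_nhds (by linarith) (by linarith)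
  filter_upwards [hmid (ε / 3) (ENNReal.div_pos hε.ne' (by norm_num)), hwin] with c hc hcw
  have hcpos : 0 < c := by linarith [hcw.1]
  have hc₀w : c₀ ∈ Ioo (c₀ / 2) (2 * c₀) := ⟨by linarith, by linarith⟩
  have hVg : MemLp (V - g) p volume := hV.sub hgp
  have m1 : ∀ {b : ℝ}, b ≠ 0 → AEStronglyMeasurable (rescaleData b (V - g)) volume := fun hb =>
    (memLp_nsRescaleData hVg hb).1
  have m2 : ∀ {b : ℝ}, b ≠ 0 → AEStronglyMeasurable (rescaleData b g) volume := fun hb =>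
    (memLp_nsRescaleData hgp hb).1
  -- the small tails
  have htail : ∀ b ∈ Ioo (c₀ / 2) (2 * c₀), eLpNorm (rescaleData b (V - g)) p volume ≤ ε / 3 := by
    intro b hb
    have hbpos : 0 < b := by linarith [hb.1]
    rw [eLpNorm_rescaleData_eq p (V - g) hbpos.ne']
    calc ‖b‖ₑ * ENNReal.ofReal |(b ^ 3)⁻¹| ^ (1 / p).toReal * eLpNorm (V - g) p volume
        ≤ K * ((ε / 3) / (K + 1)) := mul_le_mul' (hfac b hb) hgε
      _ ≤ (K + 1) * ((ε / 3) / (K + 1)) := mul_le_mul' le_self_add le_rfl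
      _ ≤ ε / 3 := ENNReal.mul_div_le
  -- the three-`ε/3` decomposition
  have e : rescaleData c V - rescaleData c₀ V =
      (rescaleData c (V - g) + (rescaleData c g - rescaleData c₀ g)) - rescaleData c₀ (V - g) := by
    rw [rescaleData_sub', rescaleData_sub']; abel
  rw [e]
  calc eLpNorm ((rescaleData c (V - g) + (rescaleData c g - rescaleData c₀ g)) -
        rescaleData c₀ (V - g)) p volume
      ≤ eLpNorm (rescaleData c (V - g) + (rescaleData c g - rescaleData c₀ g)) p volume +
          eLpNorm (rescaleData c₀ (V - g)) p volume :=
        eLpNorm_sub_le ((m1 hcpos.ne').add ((m2 hcpos.ne').sub (m2 hc₀.ne'))) (m1 hc₀.ne') hp1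
    _ ≤ (eLpNorm (rescaleData c (V - g)) p volume +
          eLpNorm (rescaleData c g - rescaleData c₀ g) p volume) +
          eLpNorm (rescaleData c₀ (V - g)) p volume := by
        gcongr
        exact eLpNorm_add_le (m1 hcpos.ne') ((m2 hcpos.ne').sub (m2 hc₀.ne')) hp1
    _ ≤ (ε / 3 + ε / 3) + ε / 3 := add_le_add (add_le_add (htail c hcw) hc) (htail c₀ hc₀w)
    _ = ε := ENNReal.add_thirds ε

/-- **A `C_t L^p` family of dilated fields**, `1 ≤ p < ∞`: if `c` is continuous and positive on
an open time set `S` and `V ∈ L^p`, then `s ↦ c(s) V(c(s) ·)` is in `C(S; L^p)`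
(`ContinuousInLpOn`). [folklore] -/
theorem continuousInLpOn_rescaleData_comp_Lp (hp1 : 1 ≤ p) (hptop : p ≠ ∞) {V : ℝ³ → ℝ³}
    (hV : MemLp V p volume) {c : ℝ → ℝ} {S : Set ℝ} (hS : IsOpen S) (hc : ContinuousOn c S)
    (hcpos : ∀ s ∈ S, 0 < c s) :
    ContinuousInLpOn S p (fun s => rescaleData (c s) V) := by
  refine ⟨fun s hs => memLp_nsRescaleData hV (hcpos s hs).ne', fun s₀ hs₀ => ?_⟩
  have hcs : Tendsto c (𝓝[S] s₀) (𝓝 (c s₀)) := by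
    have := (hc.continuousAt (hS.mem_nhds hs₀)).tendsto
    exact this.mono_left nhdsWithin_le_nhds
  exact (tendsto_eLpNorm_rescaleData_sub_Lp hp1 hptop hV (hcpos s₀ hs₀)).comp hcs

end DilationLp

/-! ### The shifted backward self-similar field as a `C_t L^p` family -/

section BackwardFieldLp

variable {p : ℝ≥0∞} {V : ℝ³ → ℝ³}

/-- For every `s`, `lerayBackward ½ 0 V (s − 1) = rescaleData (√(1−s))⁻¹ V`. [cite: Chae2007, (3.13) (arXiv p. 8)] -/
theorem lerayBackward_half_zero_sub_one' (V : ℝ³ → ℝ³) (s : ℝ) :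
    lerayBackward (1 / 2) 0 V (s - 1) = rescaleData (Real.sqrt (1 - s))⁻¹ V := by
  funext x
  rw [lerayBackward_half_zero_apply, rescaleData]
  rw [show -(s - 1) = 1 - s by ring]

/-- **The shifted backward field is in `C((−∞, 1); L^p)`** for `V ∈ L^p`, `1 ≤ p < ∞`. [folklore] -/
theorem continuousInLpOn_lerayBackward_shift_Lp (hp1 : 1 ≤ p) (hptop : p ≠ ∞)
    (hV : MemLp V p volume) {S : Set ℝ} (hS : S ⊆ Iio 1) :
    ContinuousInLpOn S p (fun s => lerayBackward (1 / 2) 0 V (s - 1)) := by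
  have hc : ContinuousOn (fun s : ℝ => (Real.sqrt (1 - s))⁻¹) (Iio 1) := by
    refine ContinuousOn.inv₀
      ((Real.continuous_sqrt.comp (continuous_const.sub continuous_id)).continuousOn) fun s hs => ?_
    exact (Real.sqrt_pos.2 (sub_pos.2 hs)).ne'
  have h := continuousInLpOn_rescaleData_comp_Lp hp1 hptop hV isOpen_Iio hc
    (fun s hs => inv_pos.2 (Real.sqrt_pos.2 (sub_pos.2 hs)))
  have h' : ContinuousInLpOn S p (fun s => rescaleData (Real.sqrt (1 - s))⁻¹ V) := h.mono hS
  simpa only [lerayBackward_half_zero_sub_one'] using h'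

/-- **The `L^p` norm of the slices of the shifted backward field**: for `s < 1` and
`c = (√(1−s))⁻¹`, `‖u_V(s−1)‖_{L^p} = c · (c⁻³)^{1/p} ‖V‖_{L^p}`. [cite: Kato1984, §1] -/
theorem eLpNorm_lerayBackward_shift_Lp (p : ℝ≥0∞) (V : ℝ³ → ℝ³) {s : ℝ} (hs : s < 1) :
    eLpNorm (lerayBackward (1 / 2) 0 V (s - 1)) p volume =
      ‖(Real.sqrt (1 - s))⁻¹‖ₑ * ENNReal.ofReal |(((Real.sqrt (1 - s))⁻¹) ^ 3)⁻¹| ^ (1 / p).toReal *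
        eLpNorm V p volume := by
  rw [lerayBackward_half_zero_sub_one']
  exact eLpNorm_rescaleData_eq p V (inv_pos.2 (Real.sqrt_pos.2 (sub_pos.2 hs))).ne'

/-- **A uniform `L^p` bound on the slices below a final time `S < 1`**: for `s ≤ S < 1`,
`‖u_V(s−1)‖_{L^p} ≤ (√(1−S))⁻¹ ‖V‖_{L^p}` (the Jacobian factor `(c⁻³)^{1/p}` is `≤ 1` since
`c = (√(1−s))⁻¹ ≥ 1`, and `c ≤ (√(1−S))⁻¹`), valid for `0 ≤ s`. [folklore] -/
theorem eLpNorm_lerayBackward_shift_le_Lp (p : ℝ≥0∞) (V : ℝ³ → ℝ³) {S s : ℝ} (hS1 : S < 1)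
    (hs0 : 0 ≤ s) (hsS : s ≤ S) :
    eLpNorm (lerayBackward (1 / 2) 0 V (s - 1)) p volume ≤
      ENNReal.ofReal (Real.sqrt (1 - S))⁻¹ * eLpNorm V p volume := by
  have hs1 : s < 1 := hsS.trans_lt hS1
  have hsq : 0 < Real.sqrt (1 - s) := Real.sqrt_pos.2 (sub_pos.2 hs1)
  have hsqS : 0 < Real.sqrt (1 - S) := Real.sqrt_pos.2 (sub_pos.2 hS1)
  set c : ℝ := (Real.sqrt (1 - s))⁻¹ with hc
  have hcpos : 0 < c := inv_pos.2 hsq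
  have hc1 : 1 ≤ c := by
    rw [hc, one_le_inv₀ hsq, Real.sqrt_le_one]
    linarith
  have hcS : c ≤ (Real.sqrt (1 - S))⁻¹ := by
    rw [hc]
    exact inv_anti₀ hsqS (Real.sqrt_le_sqrt (by linarith))
  rw [eLpNorm_lerayBackward_shift_Lp p V hs1]
  have h1 : ‖c‖ₑ ≤ ENNReal.ofReal (Real.sqrt (1 - S))⁻¹ := by
    rw [Real.enorm_eq_ofReal hcpos.le]
    exact ENNReal.ofReal_le_ofReal hcS
  have h2 : ENNReal.ofReal |(c ^ 3)⁻¹| ^ (1 / p).toReal ≤ 1 := by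
    refine ENNReal.rpow_le_one (ENNReal.ofReal_le_one.2 ?_) ENNReal.toReal_nonneg
    rw [abs_of_pos (by positivity)]
    exact inv_le_one_of_one_le₀ (one_le_pow₀ hc1)
  calc ‖c‖ₑ * ENNReal.ofReal |(c ^ 3)⁻¹| ^ (1 / p).toReal * eLpNorm V p volume
      ≤ ENNReal.ofReal (Real.sqrt (1 - S))⁻¹ * 1 * eLpNorm V p volume := by gcongr
    _ = ENNReal.ofReal (Real.sqrt (1 - S))⁻¹ * eLpNorm V p volume := by rw [mul_one]

end BackwardFieldLp

end Literature.Analysis.FluidPDE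

end
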